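import Summits.CriticalPhenomena.CardyFormulaZ2.Theses.CardyBoundaryCoulombGas
import Summits.CriticalPhenomena.CardyFormulaZ2.Theorems.BoundaryDefectGaussianR.Negative.MarkDensityPartition
import Literature.Probability.LatticeModels.CollarLegModel
import Literature.Probability.LatticeModels.DomainDiscretisation
import HarnessLib.Audit

/-!
# Line `sink-identity-calibration` — CHECKED SKELETON for the crux `BoundaryDefectGaussianR`
(item stmt-CriticalPhenomena-14132, rank-2 engine crux of route `CardyBoundaryCoulombGas`,
sub-problem `CardyFormulaZ2`; crux-plan round 1, planner
`planner-cruxplan-stmt-CriticalPhenomena-14132-sink-identity-calibr-0`, 2026-08-16)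

## The crux is INFORMAL — how this skeleton concludes it "by name"

The route item has signature `null` (route file rev 9 carries it as a comment only): there is no
constant `…Theses.CardyBoundaryCoulombGas.BoundaryDefectGaussianR`. The definition it was waiting
for, `Literature.Probability.LatticeModels.CollarLegModel` (`defn-CollarLegModel`: collar height
model, `LegInsertionData`, `IsAdmissible`, `Zins`), HAS landed (2026-08-15T23:00Z). This file
therefore contains, in §1–§3, a FAITHFUL TYPING of the informal crux text over that definition —
`BoundaryDefectGaussianR := RainbowLaw kacExponents` — and the skeleton concludes THAT constant by
name (`ledger skeleton check … --crux-decl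
Summit.CriticalPhenomena.CardyFormulaZ2.Cruxes.BoundaryDefectGaussianR.SinkIdentityCalibration.BoundaryDefectGaussianR`).
The typing is parametric in the exponent table (`RainbowLaw X`), which is exactly what this line
needs, and it is filed as a definition request so that the route decl can be set to the one-liner
`RainbowLaw kacExponents`; the composition below is insensitive to every internal detail of
`LawClause` (it only rewrites the exponent vectors), so swapping the conclusion for the route decl
is a one-line edit once the signature lands.

Typing choices, each answering a clause of the crux text or a `Disproof.lean` hazard (cdisprove
cycle 2 v4, §5): domains = bounded Jordan domains with `k` marked boundary points whose frontier is
an axis-parallel rectilinear polygon (`MarkedDomain k` + `IsRectilinear`, the predicate of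
`RectilinearCardy` stmt-5660 verbatim: H-rectilinear); lattice approximation `Ω̄ ∩ δℤ²` literally
(`latticeApprox`, via `meshVertices (closure Ω) δ`); charts = uniformizing maps `φ : ℍ → Ω` of the
tree (`ConformalEquiv`, `IsUniformizing`: onto `ℍ` and finite real preimages `u_i = w(x_i)` are
built in — H-onto, H-finite) together with boundary derivative data
`d_i = lim_{z→u_i} ‖φ'(z)‖ ∈ (0,∞)` (exists iff `x_i` is a non-corner point: H-noncorner;
`|w'(x_i)| = 1/d_i`); insertion types = `RainbowType k` (one sink whose leg number is the sum of
the sources' — H-neutral / one-sink built in, `k ≥ 2` by `exists_source`: H-k); lattice realisations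
= SEQUENCES of admissible, injective lattice data `v_n` with `δ_n v_n(i) → x_i` (H-realisation is
canonical: the jump collar of `LegInsertionData.collar`) — the sequential form IS "locally uniformly
in admissible `(x_i)`" (continuous convergence), which is also what `stub_calibration` consumes;
left side `‖Zins‖/‖Z‖` (phase-normalised by the norm), normalisation `δ^{-Σ η_i}`; right side
`C ∏_{i<j} |u_i-u_j|^{ε_ij} ∏_i d_i^{-η_i}` with `∃ C = C(τ) > 0` BEFORE `∀ Ω ∀ φ ∀ realisation`
(Disproof §5 H-onto: "type `∃ C, ∀ Ω ∀ ins ∀ (φ, x)`, never `∀ w ∃ C`"). The half-lattice `ℤ × ℕ`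
is not a clause (infinite `V`; `Zins` needs a finite domain): the Disproof's §3 shadows stay
heuristic members, exactly as the Disproof says.

## Idea (card `Ideas/sink-identity-calibration.md`, ideator 2; triage r1-1/2/3: pass ×3, ranked first by r1-2)

Treat the exponents as UNKNOWNS `X` (one-body weights `ηsrc L`, `ηsnk L`, pair exponents
`εss L L'`, `εst Lᵢ L`). The crux's own shape forces them: (M) the left side is chart-free while
the right side is covariant, so per insertion `2η_i + Σ_{j≠i} ε_ij = 0`; (F) merging adjacent
insertions is quasi-multiplicative, so `ε_ij = η(merged) − η_i − η_j`; at the sink of the family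
`(1,1,L−2; L)` the two give a CONSTANT SECOND DIFFERENCE of `L ↦ η(L)`; the exact identity
`Z[(1;1̄)] = Z` gives `η(1) = 0`; and the normalisation of the mark-density family `(1,1,1;3̄)`
SELF-CALIBRATES (its members partition a crossing event whose probability is RSW-bounded away from
`0` and is `≤ 1`), giving `η(3) = 1`. Hence `η(L) = L(L−1)/6`, `εss = LL'/3`, `εst = Lᵢ(1−L)/3` —
the full Kac column INCLUDING the sink rule `e_sink = 1 − L` (the route's feared background charge
`m₀ = −1/2`) — with no stiffness, no rim flux, no `U_q(sl₂)` boundary term, not even the universal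
integer `β₂⁺ = 1` of the card (triage sharpening r1-2 §3 / r1-3: the GPS remark made load-bearing).

## Stubs (5) and composition

* `stub_shell` (XL, HARDEST, load-bearing) — the structural shell C⁺: `∃ X, RainbowLaw X`
  (existence + covariance + pure-product form for all rainbow families in all rectilinear domains,
  exponents unidentified; inherits the crux's sharp `δ`-normalisation, Disproof §9/§11
  `sharpTwoPoint_of_twoPointLaw`).
* `stub_moebius` (M) — `RainbowLaw X → MoebiusRelations X`: uniqueness of limits across the
  `PSL(2,ℝ)`-torsor of uniformizing charts (anomaly bookkeeping = Disproof `cgLog_moebius` with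
  free exponents; needs one non-vacuous witness `(Ω, φ, u, d, δ_n, v_n)` per type — shared helper H0).
* `stub_fusion` (L) — `RainbowLaw X → FusionRelations X`: RSW/BK quasi-multiplicativity of boundary
  leg bundles at mesoscopic separation `δ ≪ r ≪ 1`, compared with the law's `r`-dependence.
* `stub_oneLegFree` (M) — `RainbowLaw X → X.ηsrc 1 = 0`: the exact lattice identity
  `‖Zins V (1;1̄)‖ = ‖Z V‖` (one free↔wired switch is invisible at `q = 1`; Disproof §5 H-k,
  `CollarLegModel` validation) + the law for `τ = (1;1̄)`.
* `stub_calibration` (M/L) — `RainbowLaw X → 3·X.ηsrc 1 + X.ηsnk 3 = 1`: the `(1,1,1;3̄)` members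
  along an edge partition a crossing event (landed Negative lemma `sum_real_markEvent_eq` is the
  `ℤ × ℕ` model of the identity), `Σ ≤ 1`, RSW lower bound in the fixed polygon, and continuous
  convergence on a compact edge segment ⇒ `δ^{s-1}` bounded above and below ⇒ `s = 1`.
* Sorry-free: `kac_unique` (the sink identity ⇒ Kac column, over the typed tables),
  `rainbowLaw_congr`, the consistency certificates `moebiusRelations_kac`, `fusionRelations_kac`,
  and the composition `BoundaryDefectGaussianR_of : Sig.stub_shell → Sig.stub_moebius →
  Sig.stub_fusion → Sig.stub_oneLegFree → Sig.stub_calibration → BoundaryDefectGaussianR`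
  (+ `boundaryDefectGaussianR_proof` from the sorried stubs).

## Disproof.lean obligations honoured (cycle 2 v4) and landed Negative lemmas

* `not_lawInAllMoebiusFrames_naiveSink`, `hw_eq_hw_iff` (the sink LABEL is forced given `h`): this
  line goes strictly further — `h` itself is forced (`kac_unique`); the naive column `ηsnk L = −L`…
  is not a stub anywhere. `cgLog_moebius_invariant` = our `moebiusRelations_kac`.
* `not_lawInAllDilatedFrames_of_hw_sum_ne_zero` (Σe ∉ {0,1} is frame-inconsistent): neutrality is
  built into `RainbowType` (sink legs = Σ source legs), so every typed family has `Σ e = 1`.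
* H-onto / H-finite / H-noncorner / H-rectilinear / H-localunif (`not_halfPlaneTwoPointLawUniform`:
  no uniformity up to the diagonal is claimed — realisations converge to DISTINCT marks).
* §9 `constant_le_of_markDensityShapeWith` / Negative `MarkDensityPartition.lean` (imported): caps
  the constant of member (i), consistent; its partition identity is the tool of `stub_calibration`.
* `ledger negatives --problem CriticalPhenomena` (8): none concerns boundary connectivities; nothing
  restated. No landed Negative lemma refutes any stub (the only landed file is the support file above).
-/

noncomputable section

open Filter Topology Set
open scoped BigOperators
open UpperHalfPlane (upperHalfPlaneSet)

namespace Summit.CriticalPhenomena.CardyFormulaZ2.Cruxes.BoundaryDefectGaussianR.SinkIdentityCalibration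

open Literature.Probability.LatticeModels (meshVertices meshVertices_finite)
open Literature.Probability.LatticeModels.CollarLegModel (CollarDomain LegInsertionData Zins)
open Literature.Probability.RandomPlanarGeometry (JordanDomain MarkedDomain ConformalEquiv)

/-! ### §1 Exponent tables and rainbow insertion types -/

/-- An **exponent table** for rainbow leg families: one-body weights of an `L`-leg SOURCE and of an
`L`-leg SINK, pair exponents between two sources (`εss L L'`) and between an `Lᵢ`-leg source and
the `L`-leg sink (`εst Lᵢ L`). In the crux these are the Kac data `kacExponents`; in the
structural shell `Sig.stub_shell` they are unknowns. [folklore] -/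
structure ExponentData where
  /-- weight `η(L)` of an `L`-leg source -/
  ηsrc : ℕ → ℝ
  /-- weight of an `L`-leg sink -/
  ηsnk : ℕ → ℝ
  /-- pair exponent of two sources with `L`, `L'` legs -/
  εss : ℕ → ℕ → ℝ
  /-- pair exponent of an `Lᵢ`-leg source and the `L`-leg sink -/
  εst : ℕ → ℕ → ℝ

/-- A **rainbow insertion type** on `k` cyclically ordered boundary points: the index of the unique
sink and the leg numbers; sources carry `≥ 1` legs, the sink carries the SUM of the sources' legs
(`Σ_i s_i L_i = 0`, written additively as `Σ_i L_i = 2·L_sink`), and there is at least one source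
(so `k ≥ 2`). The lattice realisation of a type is canonical (`LegInsertionData.collar`). [folklore] -/
structure RainbowType (k : ℕ) where
  /-- the index of the sink -/
  sink : Fin k
  /-- leg numbers (`legs sink` = the sink's leg number) -/
  legs : Fin k → ℕ
  /-- sources have at least one leg -/
  legs_pos : ∀ i, i ≠ sink → 1 ≤ legs i
  /-- neutrality: the sink's legs are the sum of the sources' legs -/
  neutral : ∑ i, legs i = 2 * legs sink
  /-- at least one source -/
  exists_source : ∃ i, i ≠ sink

namespace RainbowType

variable {k : ℕ} (τ : RainbowType k)

/-- A source has at most as many legs as the sink. [folklore] -/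
theorem legs_le_sink (i : Fin k) (hi : i ≠ τ.sink) : τ.legs i ≤ τ.legs τ.sink := by
  have h1 := Finset.add_sum_erase Finset.univ τ.legs (Finset.mem_univ τ.sink)
  have h2 : τ.legs i ≤ ∑ j ∈ Finset.univ.erase τ.sink, τ.legs j :=
    Finset.single_le_sum (f := τ.legs) (fun _ _ => Nat.zero_le _)
      (Finset.mem_erase.2 ⟨hi, Finset.mem_univ i⟩)
  have h3 := τ.neutral
  omega

/-- The sink has at least one leg. [folklore] -/
theorem one_le_legs_sink : 1 ≤ τ.legs τ.sink := by
  obtain ⟨i, hi⟩ := τ.exists_source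
  exact (τ.legs_pos i hi).trans (τ.legs_le_sink i hi)

/-- Every insertion has at least one leg. [folklore] -/
theorem one_le_legs (i : Fin k) : 1 ≤ τ.legs i := by
  by_cases hi : i = τ.sink
  · rw [hi]; exact τ.one_le_legs_sink
  · exact τ.legs_pos i hi

end RainbowType

namespace ExponentData

variable (X : ExponentData) {k : ℕ}

/-- The one-body exponent vector of a type: `η_i`. [folklore] -/
def ηvec (τ : RainbowType k) (i : Fin k) : ℝ :=
  if i = τ.sink then X.ηsnk (τ.legs i) else X.ηsrc (τ.legs i)

/-- The pair-exponent matrix of a type: `ε_ij` (`0` on the diagonal, which is never used). [folklore] -/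
def εmat (τ : RainbowType k) (i j : Fin k) : ℝ :=
  if i = j then 0
  else if j = τ.sink then X.εst (τ.legs i) (τ.legs j)
  else if i = τ.sink then X.εst (τ.legs j) (τ.legs i)
  else X.εss (τ.legs i) (τ.legs j)

end ExponentData

/-! ### §2 Lattice side: `Ω̄ ∩ δℤ²`, realised insertions, the normalised partition function -/

/-- The frontier of the Jordan domain lies in finitely many axis-parallel segments (the predicate of
`RectilinearCardy`, stmt-5660, verbatim). [folklore] -/
def IsRectilinear (D : JordanDomain) : Prop :=
  ∃ S : Finset (ℂ × ℂ), (∀ p ∈ S, p.1.re = p.2.re ∨ p.1.im = p.2.im) ∧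
    frontier D.carrier ⊆ ⋃ p ∈ S, segment ℝ p.1 p.2

/-- `Ω_δ = Ω̄ ∩ δℤ²` as a finite vertex set of `ℤ²` (crux text: "Ω_δ = Ω̄ ∩ δℤ² (induced edges
E)"); empty (junk) for `δ ≤ 0`. [folklore] -/
def latticeApprox (D : JordanDomain) (δ : ℝ) : Finset (ℤ × ℤ) :=
  if h : 0 < δ then CollarDomain.ofSites (meshVertices_finite D.isBounded.closure h).toFinset else ∅

/-- The point `δ v ∈ ℂ` of the lattice vertex `v ∈ ℤ²` at mesh `δ`. [folklore] -/
def pos (δ : ℝ) (v : ℤ × ℤ) : ℂ := ⟨δ * v.1, δ * v.2⟩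

variable {k : ℕ}

/-- The leg-insertion datum of `CollarLegModel` realising the type `τ` at the lattice points `v`
(sources with their leg numbers, the sink; its leg number `Σ` sources' is `sinkLegs`). [folklore] -/
def legData (τ : RainbowType k) (v : Fin k → ℤ × ℤ) : LegInsertionData where
  source := (Finset.univ.erase τ.sink).image v
  legs x := ∑ i ∈ (Finset.univ.erase τ.sink).filter (fun i => v i = x), τ.legs i
  sink := v τ.sink

/-- `Z_Ω^δ[ins]/Z_Ω^δ`, phase-normalised by taking norms (the crux divides out the
configuration-independent phase `e^{iθ}`; `Z = 2^{|E|} > 0`). [folklore] -/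
def ratio (V : Finset (ℤ × ℤ)) (ι : LegInsertionData) : ℝ :=
  ‖Zins V ι‖ / ‖(Literature.Probability.LatticeModels.CollarLegModel.ofDomain V).Z‖

/-! ### §3 The law, the Kac table, the typed crux -/

/-- The right-hand side `C ∏_{i<j} |u_i - u_j|^{ε_ij} ∏_i d_i^{-η_i}` (`u_i = w(x_i)`,
`d_i = |φ'(u_i)| = 1/|w'(x_i)|`). [folklore] -/
def rhs (ηv : Fin k → ℝ) (εm : Fin k → Fin k → ℝ) (C : ℝ) (u d : Fin k → ℝ) : ℝ :=
  C * (∏ i, ∏ j, if i < j then |u i - u j| ^ εm i j else 1) * ∏ i, d i ^ (-(ηv i))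

/-- **The law for one type `τ` with constant `C` and exponents `(ηv, εm)`**: for every bounded
rectilinear Jordan domain with `k` marks, every uniformizing chart `φ : ℍ → Ω` with finite real
mark preimages `u` and boundary derivative moduli `d_i ∈ (0,∞)` at them, every mesh sequence
`δ_n → 0⁺` and every sequence of injective, admissible lattice realisations `v_n` of `τ` with
`δ_n v_n(i) → x_i`:  `δ_n^{-Σ_i η_i} · ‖Z[ins]‖/‖Z‖ → rhs`. [folklore] -/
def LawClause (ηv : Fin k → ℝ) (εm : Fin k → Fin k → ℝ) (τ : RainbowType k) (C : ℝ) : Prop :=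
  ∀ (D : MarkedDomain k), IsRectilinear D.toJordanDomain →
  ∀ (φ : ConformalEquiv upperHalfPlaneSet D.carrier) (u : Fin k → ℝ), D.IsUniformizing φ u →
  ∀ (d : Fin k → ℝ), (∀ i, 0 < d i) →
    (∀ i, Tendsto (fun z : ℂ => ‖deriv (fun w : ℂ => φ w) z‖)
      (𝓝[upperHalfPlaneSet] ((u i : ℝ) : ℂ)) (𝓝 (d i))) →
  ∀ (δ : ℕ → ℝ) (v : ℕ → Fin k → ℤ × ℤ),
    (∀ n, 0 < δ n) → Tendsto δ atTop (𝓝 0) → (∀ n, Function.Injective (v n)) →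
    (∀ i, Tendsto (fun n => pos (δ n) (v n i)) atTop (𝓝 (D.pt i))) →
    (∀ n, (legData τ (v n)).IsAdmissible (latticeApprox D.toJordanDomain (δ n))) →
    Tendsto (fun n => (δ n) ^ (-(∑ i, ηv i)) *
        ratio (latticeApprox D.toJordanDomain (δ n)) (legData τ (v n)))
      atTop (𝓝 (rhs ηv εm C u d))

/-- **Rainbow law with exponent table `X`**: for every rainbow type there is ONE constant
`C = C(τ) ∈ (0,∞)` serving all domains, charts and realisations. [folklore] -/
def RainbowLaw (X : ExponentData) : Prop :=
  ∀ (k : ℕ) (τ : RainbowType k), ∃ C : ℝ, 0 < C ∧ LawClause (X.ηvec τ) (X.εmat τ) τ C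

/-- The boundary Kac weight `h(e) = e(e-1)/6` (`= h_{1,L+1}` at `e ∈ {L, 1-L}`; Disproof `hw`). [folklore] -/
def kacWeight (e : ℝ) : ℝ := e * (e - 1) / 6

/-- **The Kac exponent table of the crux**: labels `e = L` at a source, `e = 1 - L` at the sink
(the "sink rule" / background charge), weights `h(e)`, pair exponents `e_i e_j / 3`. [folklore] -/
def kacExponents : ExponentData where
  ηsrc L := kacWeight L
  ηsnk L := kacWeight (1 - L)
  εss L L' := (L : ℝ) * L' / 3
  εst Li L := (Li : ℝ) * (1 - L) / 3

set_option linter.dupNamespace false in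
/-- **PROPOSED TYPING of the informal crux `BoundaryDefectGaussianR` (stmt-CriticalPhenomena-14132)**:
rainbow leg families of the closed-collar `Δ = -1/2` height model are Coulomb-gas pure products with
the Kac exponents, in every bounded rectilinear domain, covariantly under every uniformizing chart,
locally uniformly in admissible positions (sequential form). The skeleton concludes THIS constant
by name (`--crux-decl`); see the module docstring. [folklore] -/
def BoundaryDefectGaussianR : Prop := RainbowLaw kacExponents

/-! ### §4 The relations the stubs extract from a law, and the stub signatures -/

/-- (M) **Möbius / frame relations**: per insertion point, `2η_i + Σ_{j≠i} ε_ij = 0` (the exponent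
of `|g'(u_i)|` picked up by the right side under a real Möbius change of chart must vanish, because
the left side does not see the chart). [folklore] -/
def MoebiusRelations (X : ExponentData) : Prop :=
  ∀ (k : ℕ) (τ : RainbowType k) (i : Fin k), 2 * X.ηvec τ i + ∑ j, X.εmat τ i j = 0

/-- (F) **Fusion relations**: merging two adjacent sources gives a source with `L + L'` legs,
merging an `Lᵢ`-leg source into the `L`-leg sink leaves a sink with `L - Lᵢ` legs; the pair
exponent is the difference of one-body weights (quasi-multiplicativity). [folklore] -/
def FusionRelations (X : ExponentData) : Prop :=
  (∀ L L' : ℕ, 1 ≤ L → 1 ≤ L' → X.εss L L' = X.ηsrc (L + L') - X.ηsrc L - X.ηsrc L') ∧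
  (∀ Li L : ℕ, 1 ≤ Li → Li < L → X.εst Li L = X.ηsnk (L - Li) - X.ηsrc Li - X.ηsnk L)

/-- STUB 1 statement (XL, hardest, load-bearing) — the **structural shell C⁺**: SOME exponent
table obeys the rainbow law (existence of the scaling limits + conformal covariance + pure-product
form, for all rainbow families in all bounded rectilinear domains; exponents UNIDENTIFIED).
Strictly weaker than the crux (which is the instance `X = kacExponents`). [folklore] -/
def StructuralShell : Prop := ∃ X : ExponentData, RainbowLaw X

/-- STUB 2 statement (M) — **a law forces the Möbius relations of its table**: the left side of
`LawClause` does not see the chart, the right side transforms under `φ ↦ φ ∘ g⁻¹`, `g ∈ PSL(2,ℝ)`,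
by `∏_i |g'(u_i)|^{η_i + Σ_{j≠i} ε_ij/2}`; uniqueness of limits along ONE non-vacuous realisation
per type (helper H0) and `d ↦ Σ_i a_i log|u_i + d| ≡ const ⇒ a_i = 0`. [folklore] -/
def MoebiusOfLaw : Prop := ∀ X : ExponentData, RainbowLaw X → MoebiusRelations X

/-- STUB 3 statement (L) — **a law forces the fusion relations of its table**: RSW/BK
quasi-multiplicativity of boundary leg bundles, `P[ins] ≍ P[merged]·π_a(δ,r)π_b(δ,r)/π_{ab}(δ,r)`
uniformly in `δ ≤ r ≤ r₀` (exponent-free, triage r1-2 sharpening), compared with the law's own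
`r^{ε_ab}` and `δ`-dependence of the 2- and 3-point members. [folklore] -/
def FusionOfLaw : Prop := ∀ X : ExponentData, RainbowLaw X → FusionRelations X

/-- STUB 4 statement (M) — **one leg is free**: for the type `(1;1̄)` the jump collar is one wired
arc, `‖Zins V ι‖ = ‖Z V‖` EXACTLY on every admissible `(V, ι)` (a single free↔wired switch is
invisible at `q = 1`; Disproof §5 H-k, `CollarLegModel` validation), so `δ^{-2η(1)} → C·rhs`
forces `η(1) = 0`. [folklore] -/
def OneLegFree : Prop := ∀ X : ExponentData, RainbowLaw X → X.ηsrc 1 = 0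

/-- STUB 5 statement (M/L) — **self-calibration of the mark density**: for the family `(1,1,1;3̄)`
with the sink moving along an edge segment, the lattice events are the mark events
`{x' ↔ [a,b]} ∖ {[c,x] ↔ [a,b]}`, pairwise disjoint with union a crossing event (landed Negative
lemma `sum_real_markEvent_eq` on `ℤ × ℕ`), so their sum is `≤ 1` and RSW-bounded below in the
fixed polygon; continuous convergence on the compact segment then gives `δ^{s-1} ≍ 1`, i.e. the
total exponent `s = 3η(1) + ηsnk(3)` is exactly `1`. [folklore] -/
def MarkDensityCalibration : Prop :=
  ∀ X : ExponentData, RainbowLaw X → 3 * X.ηsrc 1 + X.ηsnk 3 = 1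

/-! ### §5 The registered stubs (the ONLY `sorry`s of this file)

Each `stub_<name>` states its obligation INLINE (so the registered signature is the statement);
`Sig.stub_<name>` are the name-keyed aliases the composition takes as hypotheses (device of
`Cruxes/EdgePrecompact/Lines/shift-coupling-phase-exact.lean` / `LoopsToCrossings/Lines/br-sandwich-diagonal.lean`:
the skeleton audit admits hypotheses that are registered stubs BY NAME). -/

/-- STUB 1 — structural shell C⁺ (`StructuralShell`). -/
theorem stub_shell : ∃ X : ExponentData, RainbowLaw X := by
  sorry

/-- STUB 2 — Möbius relations from a law (`MoebiusOfLaw`). -/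
theorem stub_moebius : ∀ X : ExponentData, RainbowLaw X → MoebiusRelations X := by
  sorry

/-- STUB 3 — fusion relations from a law (`FusionOfLaw`). -/
theorem stub_fusion : ∀ X : ExponentData, RainbowLaw X → FusionRelations X := by
  sorry

/-- STUB 4 — one leg is free (`OneLegFree`). -/
theorem stub_oneLegFree : ∀ X : ExponentData, RainbowLaw X → X.ηsrc 1 = 0 := by
  sorry

/-- STUB 5 — self-calibration of the mark density (`MarkDensityCalibration`). -/
theorem stub_calibration : ∀ X : ExponentData, RainbowLaw X → 3 * X.ηsrc 1 + X.ηsnk 3 = 1 := by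
  sorry

namespace Sig

/-- Alias of `StructuralShell` keyed by the registered stub name. -/
abbrev stub_shell : Prop := StructuralShell
/-- Alias of `MoebiusOfLaw` keyed by the registered stub name. -/
abbrev stub_moebius : Prop := MoebiusOfLaw
/-- Alias of `FusionOfLaw` keyed by the registered stub name. -/
abbrev stub_fusion : Prop := FusionOfLaw
/-- Alias of `OneLegFree` keyed by the registered stub name. -/
abbrev stub_oneLegFree : Prop := OneLegFree
/-- Alias of `MarkDensityCalibration` keyed by the registered stub name. -/
abbrev stub_calibration : Prop := MarkDensityCalibration

end Sig

/-! ### §6 The sink identity: the four relations force the Kac table (sorry-free) -/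

section Algebra

variable (X : ExponentData)

/-- The two-point type `(L; L̄)`: an `L`-leg source at index `0`, the `L`-leg sink at index `1`. [folklore] -/
def twoPoint (L : ℕ) (hL : 1 ≤ L) : RainbowType 2 where
  sink := 1
  legs := ![L, L]
  legs_pos := by intro i _; fin_cases i <;> simp [hL]
  neutral := by simp [Fin.sum_univ_two]; ring
  exists_source := ⟨0, by decide⟩

/-- The calibrating family `(1, 1, L-2; L̄)`, `L ≥ 3`: sources `1, 1, L-2` at indices `0,1,2`,
the `L`-leg sink at index `3`. [folklore] -/
def family3 (L : ℕ) (hL : 3 ≤ L) : RainbowType 4 where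
  sink := 3
  legs := ![1, 1, L - 2, L]
  legs_pos := by
    intro i _
    fin_cases i <;> simp <;> omega
  neutral := by
    simp [Fin.sum_univ_four]
    omega
  exists_source := ⟨0, by decide⟩

private theorem f2_01 : (0 : Fin 2) ≠ 1 := by decide
private theorem f4_03 : (0 : Fin 4) ≠ 3 := by decide
private theorem f4_13 : (1 : Fin 4) ≠ 3 := by decide
private theorem f4_23 : (2 : Fin 4) ≠ 3 := by decide
private theorem f4_30 : (3 : Fin 4) ≠ 0 := by decide
private theorem f4_31 : (3 : Fin 4) ≠ 1 := by decide
private theorem f4_32 : (3 : Fin 4) ≠ 2 := by decide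

/-- (M) on the two-point type: source and sink weights agree and the pair exponent is `-2η(L)`. [folklore] -/
theorem twoPoint_relations (hM : MoebiusRelations X) (L : ℕ) (hL : 1 ≤ L) :
    X.ηsnk L = X.ηsrc L ∧ X.εst L L = -2 * X.ηsrc L := by
  have h0 := hM 2 (twoPoint L hL) 0
  have h1 := hM 2 (twoPoint L hL) 1
  simp [ExponentData.ηvec, ExponentData.εmat, twoPoint, Fin.sum_univ_two, f2_01.symm] at h0 h1
  constructor <;> linarith

/-- (M) at the sink of `(1,1,L-2; L̄)` combined with (F): the sink identity, i.e. the recursion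
`η(L) = 2η(L-1) - η(L-2) + η(2) - 2η(1)` for `L ≥ 3`. [folklore] -/
theorem sink_identity (hM : MoebiusRelations X) (hF : FusionRelations X) (L : ℕ) (hL : 3 ≤ L) :
    X.ηsrc L = 2 * X.ηsrc (L - 1) - X.ηsrc (L - 2) + X.ηsrc 2 - 2 * X.ηsrc 1 := by
  have h3 := hM 4 (family3 L hL) 3
  simp [ExponentData.ηvec, ExponentData.εmat, family3, Fin.sum_univ_four, f4_03, f4_13, f4_23,
    f4_30, f4_31, f4_32] at h3
  -- h3 : 2 * X.ηsnk L + (X.εst 1 L + (X.εst 1 L + X.εst (L - 2) L)) = 0  (up to normal form)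
  have hF1 : X.εst 1 L = X.ηsnk (L - 1) - X.ηsrc 1 - X.ηsnk L := hF.2 1 L le_rfl (by omega)
  have hF2 : X.εst (L - 2) L = X.ηsnk (L - (L - 2)) - X.ηsrc (L - 2) - X.ηsnk L :=
    hF.2 (L - 2) L (by omega) (by omega)
  have hLL : L - (L - 2) = 2 := by omega
  rw [hLL] at hF2
  have e1 := (twoPoint_relations X hM L (by omega)).1
  have e2 := (twoPoint_relations X hM (L - 1) (by omega)).1
  have e3 := (twoPoint_relations X hM 2 (by omega)).1
  linarith

/-- **The sink identity calibrates the whole column**: (M), (F), `η(1) = 0` and the calibration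
`3η(1) + ηsnk(3) = 1` force `η(L) = L(L-1)/6` for every `L ≥ 1` (card's `kac_of_sink_identity`,
here over the typed tables). [folklore] -/
theorem eta_formula (hM : MoebiusRelations X) (hF : FusionRelations X) (h1 : X.ηsrc 1 = 0)
    (hc : 3 * X.ηsrc 1 + X.ηsnk 3 = 1) :
    ∀ L : ℕ, 1 ≤ L → X.ηsrc L = (L : ℝ) * ((L : ℝ) - 1) / 6 := by
  have h3 : X.ηsrc 3 = 1 := by
    have e := (twoPoint_relations X hM 3 (by norm_num)).1
    linarith
  have h2 : X.ηsrc 2 = 1 / 3 := by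
    have r := sink_identity X hM hF 3 le_rfl
    norm_num at r
    linarith
  -- strong induction
  suffices H : ∀ n L : ℕ, L ≤ n → 1 ≤ L → X.ηsrc L = (L : ℝ) * ((L : ℝ) - 1) / 6 from
    fun L hL => H L L le_rfl hL
  intro n
  induction n with
  | zero => intro L hL hL1; omega
  | succ n ih =>
    intro L hL hL1
    rcases Nat.lt_or_ge L 3 with hlt | hge
    · interval_cases L
      · simp [h1]
      · rw [h2]; norm_num
    · have r := sink_identity X hM hF L hge
      have ih1 := ih (L - 1) (by omega) (by omega)
      have ih2 := ih (L - 2) (by omega) (by omega)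
      rw [r, ih1, ih2, h2, h1]
      have c1 : ((L - 1 : ℕ) : ℝ) = (L : ℝ) - 1 := by
        rw [Nat.cast_sub (by omega)]; simp
      have c2 : ((L - 2 : ℕ) : ℝ) = (L : ℝ) - 2 := by
        rw [Nat.cast_sub (by omega)]; norm_num
      rw [c1, c2]
      ring

/-- **Uniqueness (the heart of the line)**: under (M), (F), one-leg-free and the calibration, the
table `X` agrees with the Kac table on every entry a rainbow type can evaluate: source and sink
weights for `L ≥ 1`, source–source exponents for `L, L' ≥ 1`, source–sink exponents for
`1 ≤ Lᵢ ≤ L` — in particular the sink rule `εst Lᵢ L = Lᵢ(1-L)/3`. [folklore] -/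
theorem kac_unique (hM : MoebiusRelations X) (hF : FusionRelations X) (h1 : X.ηsrc 1 = 0)
    (hc : 3 * X.ηsrc 1 + X.ηsnk 3 = 1) :
    (∀ L, 1 ≤ L → X.ηsrc L = kacExponents.ηsrc L) ∧
    (∀ L, 1 ≤ L → X.ηsnk L = kacExponents.ηsnk L) ∧
    (∀ L L', 1 ≤ L → 1 ≤ L' → X.εss L L' = kacExponents.εss L L') ∧
    (∀ Li L, 1 ≤ Li → Li ≤ L → X.εst Li L = kacExponents.εst Li L) := by
  have hη := eta_formula X hM hF h1 hc
  refine ⟨fun L hL => ?_, fun L hL => ?_, fun L L' hL hL' => ?_, fun Li L hLi hLiL => ?_⟩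
  · rw [hη L hL]; simp [kacExponents, kacWeight]
  · rw [(twoPoint_relations X hM L hL).1, hη L hL]; simp [kacExponents, kacWeight]; ring
  · rw [hF.1 L L' hL hL', hη L hL, hη L' hL', hη (L + L') (by omega)]
    simp [kacExponents]; ring
  · rcases Nat.lt_or_ge Li L with hlt | hge
    · rw [hF.2 Li L hLi hlt, (twoPoint_relations X hM (L - Li) (by omega)).1,
        (twoPoint_relations X hM L (by omega)).1, hη Li hLi, hη L (by omega), hη (L - Li) (by omega)]
      simp [kacExponents]
      rw [Nat.cast_sub hLiL]
      ring
    · have hEq : Li = L := le_antisymm hLiL hge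
      subst hEq
      rw [(twoPoint_relations X hM Li hLi).2, hη Li hLi]
      simp [kacExponents]
      ring

/-- The exponent vectors of `X` and of the Kac table agree on every type. [folklore] -/
theorem ηvec_eq_kac (hM : MoebiusRelations X) (hF : FusionRelations X) (h1 : X.ηsrc 1 = 0)
    (hc : 3 * X.ηsrc 1 + X.ηsnk 3 = 1) {k : ℕ} (τ : RainbowType k) :
    X.ηvec τ = kacExponents.ηvec τ := by
  obtain ⟨hs, hk, -, -⟩ := kac_unique X hM hF h1 hc
  funext i
  unfold ExponentData.ηvec
  split_ifs with hi
  · exact hk _ (hi ▸ τ.one_le_legs_sink)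
  · exact hs _ (τ.one_le_legs i)

/-- The pair-exponent matrices of `X` and of the Kac table agree on every type. [folklore] -/
theorem εmat_eq_kac (hM : MoebiusRelations X) (hF : FusionRelations X) (h1 : X.ηsrc 1 = 0)
    (hc : 3 * X.ηsrc 1 + X.ηsnk 3 = 1) {k : ℕ} (τ : RainbowType k) :
    X.εmat τ = kacExponents.εmat τ := by
  obtain ⟨-, -, hss, hst⟩ := kac_unique X hM hF h1 hc
  funext i j
  unfold ExponentData.εmat
  split_ifs with hij hj hi
  · rfl
  · have hi : i ≠ τ.sink := fun h => hij (h.trans hj.symm)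
    rw [hj]
    exact hst _ _ (τ.one_le_legs i) (τ.legs_le_sink i hi)
  · have hj' : j ≠ τ.sink := hj
    rw [hi]
    exact hst _ _ (τ.one_le_legs j) (τ.legs_le_sink j hj')
  · exact hss _ _ (τ.one_le_legs i) (τ.one_le_legs j)

end Algebra

/-- A rainbow law only sees the exponent vectors and matrices of its table. [folklore] -/
theorem rainbowLaw_congr {X Y : ExponentData} (hη : ∀ (k : ℕ) (τ : RainbowType k), X.ηvec τ = Y.ηvec τ)
    (hε : ∀ (k : ℕ) (τ : RainbowType k), X.εmat τ = Y.εmat τ) (h : RainbowLaw X) : RainbowLaw Y := by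
  intro k τ
  obtain ⟨C, hC, hcl⟩ := h k τ
  refine ⟨C, hC, ?_⟩
  rw [← hη, ← hε]
  exact hcl

/-! ### §7 Consistency certificates: the Kac table solves all four relations (sorry-free)

So the conclusions of stubs 2–5 are jointly satisfiable at `X = kacExponents` (the crux implies
each of them with `X := kacExponents` via `stub_shell`'s witness): the relations do not secretly
contradict the crux. `moebiusRelations_kac` is the Lean form of Disproof `cgLog_moebius_invariant`
(frame consistency of the Kac product ⇔ `Σ e = 1`). -/

/-- Labels of a type: `e_i = L_i` at a source, `1 - L` at the sink. [folklore] -/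
def label {k : ℕ} (τ : RainbowType k) (i : Fin k) : ℝ :=
  if i = τ.sink then 1 - (τ.legs i : ℝ) else (τ.legs i : ℝ)

/-- Neutrality in label form: `Σ_i e_i = 1`. [folklore] -/
theorem sum_label {k : ℕ} (τ : RainbowType k) : ∑ i, label τ i = 1 := by
  have hsplit := Finset.add_sum_erase Finset.univ (label τ) (Finset.mem_univ τ.sink)
  have hsrc : ∑ i ∈ Finset.univ.erase τ.sink, label τ i
      = ∑ i ∈ Finset.univ.erase τ.sink, (τ.legs i : ℝ) := by
    refine Finset.sum_congr rfl fun i hi => ?_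
    rw [Finset.mem_erase] at hi
    simp [label, hi.1]
  have hnat := Finset.add_sum_erase Finset.univ τ.legs (Finset.mem_univ τ.sink)
  have hneu := τ.neutral
  have hcast : (∑ i ∈ Finset.univ.erase τ.sink, (τ.legs i : ℝ))
      = ((∑ i ∈ Finset.univ.erase τ.sink, τ.legs i : ℕ) : ℝ) := by push_cast; rfl
  have hsum : (∑ i ∈ Finset.univ.erase τ.sink, τ.legs i : ℕ) = τ.legs τ.sink := by omega
  rw [← hsplit, hsrc, hcast, hsum]
  simp [label]

/-- The Kac vector is `h(e_i)`. [folklore] -/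
theorem kac_ηvec {k : ℕ} (τ : RainbowType k) (i : Fin k) :
    kacExponents.ηvec τ i = kacWeight (label τ i) := by
  unfold ExponentData.ηvec label
  split_ifs <;> simp [kacExponents]

/-- The Kac matrix is `e_i e_j / 3` off the diagonal. [folklore] -/
theorem kac_εmat {k : ℕ} (τ : RainbowType k) (i j : Fin k) (hij : i ≠ j) :
    kacExponents.εmat τ i j = label τ i * label τ j / 3 := by
  unfold ExponentData.εmat label
  rw [if_neg hij]
  by_cases hj : j = τ.sink
  · have hi : i ≠ τ.sink := fun h => hij (h.trans hj.symm)
    simp [hj, hi, kacExponents]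
  · by_cases hi : i = τ.sink
    · have hj' : ¬ j = τ.sink := hj
      simp [hi, hj', kacExponents]
      ring
    · simp [hi, hj, kacExponents]

/-- **The Kac table satisfies the Möbius relations** (for EVERY rainbow type): `2h(e_i) +
e_i Σ_{j≠i} e_j /3 = e_i (Σ_j e_j - 1)/3 = 0` by neutrality. [folklore] -/
theorem moebiusRelations_kac : MoebiusRelations kacExponents := by
  intro k τ i
  have hsum : ∑ j, kacExponents.εmat τ i j = ∑ j ∈ Finset.univ.erase i, label τ i * label τ j / 3 := by
    rw [← Finset.add_sum_erase Finset.univ _ (Finset.mem_univ i)]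
    have h0 : kacExponents.εmat τ i i = 0 := by simp [ExponentData.εmat]
    rw [h0, zero_add]
    refine Finset.sum_congr rfl fun j hj => ?_
    rw [Finset.mem_erase] at hj
    exact kac_εmat τ i j (Ne.symm hj.1)
  have herase : ∑ j ∈ Finset.univ.erase i, label τ i * label τ j / 3
      = label τ i * (1 - label τ i) / 3 := by
    rw [← sum_label τ, ← Finset.add_sum_erase Finset.univ (label τ) (Finset.mem_univ i)]
    rw [← Finset.sum_div, ← Finset.mul_sum]
    ring
  rw [hsum, herase, kac_ηvec]
  unfold kacWeight
  ring

/-- The Kac table satisfies the fusion relations (`h(a+b) - h(a) - h(b) = ab/3`). [folklore] -/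
theorem fusionRelations_kac : FusionRelations kacExponents := by
  constructor
  · intro L L' _ _
    simp [kacExponents, kacWeight]
    ring
  · intro Li L _ hlt
    simp [kacExponents, kacWeight]
    rw [Nat.cast_sub hlt.le]
    ring

/-- The Kac table has `η(1) = 0` and total mark-density exponent `3·0 + h(-2) = 1`. [folklore] -/
theorem oneLeg_and_calibration_kac :
    kacExponents.ηsrc 1 = 0 ∧ 3 * kacExponents.ηsrc 1 + kacExponents.ηsnk 3 = 1 := by
  constructor <;> norm_num [kacExponents, kacWeight]

/-- The shell is NECESSARY: the crux is its instance `X = kacExponents` (so, modulo stubs 2–5, the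
transfer `C⁺` is an equivalent form of the crux, not a costume). [folklore] -/
theorem structuralShell_of_crux (h : BoundaryDefectGaussianR) : StructuralShell := ⟨kacExponents, h⟩

/-! ### §8 The composition (concludes the typed crux BY NAME; no `sorry`) -/

/-- **`BoundaryDefectGaussianR` from the five stubs.** Take the shell's table `X` (STUB 1); STUBS
2–5 give (M), (F), `η(1) = 0` and the calibration for `X`; `kac_unique` identifies `X` with the
Kac table on every entry a rainbow type evaluates (`ηvec_eq_kac`, `εmat_eq_kac`); the law only sees
those entries (`rainbowLaw_congr`). -/
theorem BoundaryDefectGaussianR_of (h₁ : Sig.stub_shell) (h₂ : Sig.stub_moebius)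
    (h₃ : Sig.stub_fusion) (h₄ : Sig.stub_oneLegFree) (h₅ : Sig.stub_calibration) :
    BoundaryDefectGaussianR := by
  obtain ⟨X, hX⟩ := h₁
  have hM := h₂ X hX
  have hF := h₃ X hX
  have h1 := h₄ X hX
  have hc := h₅ X hX
  exact rainbowLaw_congr (fun k τ => ηvec_eq_kac X hM hF h1 hc τ)
    (fun k τ => εmat_eq_kac X hM hF h1 hc τ) hX

/-- The typed crux from the registered (sorried) stubs — the lead's closing theorem. -/
theorem boundaryDefectGaussianR_proof : BoundaryDefectGaussianR :=
  BoundaryDefectGaussianR_of stub_shell stub_moebius stub_fusion stub_oneLegFree stub_calibration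

end Summit.CriticalPhenomena.CardyFormulaZ2.Cruxes.BoundaryDefectGaussianR.SinkIdentityCalibration

end

#h21_check_skeleton "stmt-CriticalPhenomena-14132" Summit.CriticalPhenomena.CardyFormulaZ2.Cruxes.BoundaryDefectGaussianR.SinkIdentityCalibration.BoundaryDefectGaussianR stub_shell stub_moebius stub_fusion stub_oneLegFree stub_calibration
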